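import Summits.Langlands.Langlands.Theses.OrdinaryPrimeTransport
import Summits.Langlands.Langlands.Theorems.BaseFieldAscentReciprocityTRCMPotentialAutomorphyCMTightness
import Literature.NumberTheory.DiophantineGeometry.BcgpResiduallyA5bModular
import Literature.NumberTheory.Automorphic.IsAutomorphicAE
import HarnessLib

/-!
# F4 `_onpath` — `Langlands → AbelianThreefoldPotentialAutomorphy` and `E → AbelianThreefoldPotentialAutomorphy` (line
`AbelianThreefoldPotentialAutomorphy`, crux `ReciprocityUpToIrreducibility`, item stmt-Langlands-14328; G4 ladder-down generation 31)

The rung (and every member `PotentiallyAutomorphicAbelianVarietyTR g`, `g ≥ 1`) is a CONSEQUENCE of the summit and of the top E: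
from `Langlands K` (resp. E at `K`, E named through its `Iff.rfl`-equal copy in route `OrdinaryPrimeTransport`, the module the crux-workfile farm path serves) take `Rec`, clause (B) at `n = 2g` with the in-tree compactness input
`isCompact_glFiniteIntegralLevel_holds`, feed it the irreducible geometric `r` (geometricity for `Rec` is literally the pair of
the a.e.-unramified and the Fontaine-de-Rham hypotheses, `Rec.pst = fontainePstAdicCompletion` by `rfl`), and read the first
conjunct of `Corresponds` (a.e. `SatakeFrobCompatibleAt`) over the witness extension `L := K` (`IsGalois.self`, restriction
along the identity = change of frame: `Theorems.ReciprocityTRCM.satakeFrobCompatibleAt_restrictField_self`).  Sorry-free; the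
on-path lemma `AbelianThreefoldPotentialAutomorphy_of_Langlands` is tagged `@[aesop safe apply]` (tribunal forward mode:
`S → C` closes by `intro h; aesop`).
-/

noncomputable section

set_option linter.dupNamespace false
open scoped MatrixGroups Matrix NumberField Classical
open Filter IsDedekindDomain IsDedekindDomain.HeightOneSpectrum CategoryTheory
open Literature.NumberTheory.Automorphic Literature.NumberTheory.GaloisRepresentations
open Literature.NumberTheory.PAdicHodge Literature.NumberTheory.DiophantineGeometry
open Literature.AlgebraicGeometry.Motives (AbelianVariety)
open NumberField
open Summit.Langlands

namespace Summit.Langlands.Langlands.Cruxes.ReciprocityUpToIrreducibility.AbelianThreefoldPotentialAutomorphy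

/-! ## 1. Vocabulary: framed duals of Tate modules, potential automorphy, the family -/

/-- `r` is the framed dual of `V_ℓ(A)` in the dual basis of `b` (verbatim the clause of the BCGP / FLS facts):
`r(γ) = [γ⁻¹]_bᵀ`, i.e. `H¹_ét(A_{K̄}, ℚ_ℓ) ⊗ ℚ̄_ℓ` framed. -/
def IsFramedDualTate {K : Type} [Field K] [NumberField K] (A : AbelianVariety K) (ℓ : ℕ) [Fact ℓ.Prime]
    {m : ℕ} (b : Module.Basis (Fin m) ℚ_[ℓ] (A.rationalTateModule ℓ))
    (r : FramedGaloisRep K (PadicAlgCl ℓ) m) : Prop :=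
  ∀ g : Field.absoluteGaloisGroup K,
    (r g).val = ((LinearMap.toMatrix b b (A.rationalTateRep ℓ g⁻¹)).map (algebraMap ℚ_[ℓ] (PadicAlgCl ℓ))).transpose

/-- **`r` is potentially automorphic (via `ι`)** — BCGP 2021, Def. 9.1.1 and §9.1 ("there is a finite extension of number
fields `L/K` such that `𝓡|_{G_L}` is automorphic"; Galois in Thm. 1.1.3), read in the summit's almost-everywhere vocabulary:
there are a finite Galois extension `L/K`, the compactness input for `GL_m` over `L`, and an `L`-algebraic AUTOMORPHIC (not
asserted cuspidal: an isobaric sum is allowed, as in print) representation `P` of `GL_m(𝔸_L)` that is Satake–Frobenius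
compatible with `r|_{Γ_L}` (`FramedGaloisRep.restrictField`) at all but finitely many places of `L`. -/
def IsPotentiallyAutomorphic (K : Type) [Field K] [NumberField K] (ℓ : ℕ) [Fact ℓ.Prime] {m : ℕ}
    (ι : PadicAlgCl ℓ ≃+* ℂ) (r : FramedGaloisRep K (PadicAlgCl ℓ) m) : Prop :=
  ∃ (L : Type) (_ : Field L) (_ : NumberField L) (_ : Algebra K L) (_ : IsGalois K L)
    (hcpt : isCompact_glFiniteIntegralLevel m L) (P : AutomorphicRepData (AutomorphyDatum.gl m L hcpt)),
    P.IsLAlgebraic ∧ ∀ᶠ w : HeightOneSpectrum (𝓞 L) in cofinite, SatakeFrobCompatibleAt ι P (r.restrictField L) w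

/-- **THE RUNG FAMILY, dial = the dimension `g = dim A`.**  For every totally real `K`, every abelian variety `A/K` of
dimension `g`, every prime `ℓ`, every framed dual `r : Γ_K → GL_{2g}(ℚ̄_ℓ)` of `V_ℓ(A)` which is irreducible, a.e. unramified
and de Rham above `ℓ` (Fontaine's pinned datum `fontainePstAdicCompletion`), and every `ι`: `r` is potentially automorphic. -/
def PotentiallyAutomorphicAbelianVarietyTR (g : ℕ) : Prop :=
  ∀ (K : Type) [Field K] [NumberField K] [IsTotallyReal K] (A : AbelianVariety K), A.dim = g →
    ∀ (ℓ : ℕ) [Fact ℓ.Prime] (b : Module.Basis (Fin (2 * g)) ℚ_[ℓ] (A.rationalTateModule ℓ))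
      (r : FramedGaloisRep K (PadicAlgCl ℓ) (2 * g)), IsFramedDualTate A ℓ b r →
      r.toGaloisRep.IsIrreducible →
      (∀ᶠ v : HeightOneSpectrum (𝓞 K) in cofinite, r.IsUnramifiedAt v) →
      (∀ (w : HeightOneSpectrum (𝓞 K)) (hw : ((ℓ : ℕ) : 𝓞 K) ∈ w.asIdeal),
          (fontainePstAdicCompletion w ℓ hw).IsDeRhamFramed (r.toLocal w)) →
      ∀ ι : PadicAlgCl ℓ ≃+* ℂ, IsPotentiallyAutomorphic K ℓ ι r

/-- **THE RUNG (θ31 = 3)**: abelian THREEFOLDS over totally real fields are potentially automorphic. -/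
-- @[stub "AbelianThreefoldPotentialAutomorphy"]
def AbelianThreefoldPotentialAutomorphy : Prop := PotentiallyAutomorphicAbelianVarietyTR 3

/-- **Above the rung (θ31 ≥ 4)**: abelian varieties of every dimension `≥ 4` over totally real fields. -/
-- @[stub "AbelianThreefoldPotentialAutomorphy"]
def HigherGenusPotentialAutomorphy : Prop := ∀ g : ℕ, 4 ≤ g → PotentiallyAutomorphicAbelianVarietyTR g

/-- **Floor text** (obligation node): the member `g = 2` as printed — Boxer–Calegari–Gee–Pilloni 2021, Thm. 1.1.3, in
abelian-variety / `GL₄` a.e.-Satake form; this is VERBATIM the body of the named fact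
`Literature.NumberTheory.Automorphic.bcgp2021_potentiallyAutomorphic_abelianSurface` (p214362, vendored by this unit; in print,
XL to discharge in the tree). [cite: BoxerEtAl2021, Thm. 1.1.3] -/
-- @[stub "AbelianThreefoldPotentialAutomorphy"]
def FloorText : Prop :=
  ∀ (F : Type) [Field F] [NumberField F] [IsTotallyReal F] (A : AbelianVariety F), A.dim = 2 →
    ∀ (ℓ : ℕ) [Fact ℓ.Prime] (b : Module.Basis (Fin 4) ℚ_[ℓ] (A.rationalTateModule ℓ))
      (r : FramedGaloisRep F (PadicAlgCl ℓ) 4),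
      (∀ g : Field.absoluteGaloisGroup F,
        (r g).val =
          ((LinearMap.toMatrix b b (A.rationalTateRep ℓ g⁻¹)).map
            (algebraMap ℚ_[ℓ] (PadicAlgCl ℓ))).transpose) →
      ∀ (ι : PadicAlgCl ℓ ≃+* ℂ),
        ∃ (L : Type) (_ : Field L) (_ : NumberField L) (_ : Algebra F L) (_ : IsGalois F L)
          (hcpt : isCompact_glFiniteIntegralLevel 4 L) (P : AutomorphicRepData (AutomorphyDatum.gl 4 L hcpt)),
          P.IsLAlgebraic ∧
            ∀ᶠ w : HeightOneSpectrum (𝓞 L) in Filter.cofinite, ∃ a : Multiset ℂ,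
              P.HasSatakeParamAt w a ∧ (r.restrictField L).IsUnramifiedAt w ∧
                (r.restrictField L).HasFrobCharpolyAt w (arithFrobPolyOfSatake ι w.residueCard 1 a)

/-! ## 6. The rung is a consequence of the top and of the summit (sorry-free) -/

/-- `E → PotentiallyAutomorphicAbelianVarietyTR g` for every `g ≥ 1` (witness `L := K`: clause (B) at `n = 2g` gives a
cuspidal `L`-algebraic `π` with `Corresponds Rec ι π.1 r`, whose first conjunct is the a.e. Satake clause; restriction along the
identity is a change of frame, `Theorems.ReciprocityTRCM.satakeFrobCompatibleAt_restrictField_self`). -/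
theorem potAut_of_top (g : ℕ) (hg : 1 ≤ g)
    (hE : Summit.Langlands.Langlands.Theses.OrdinaryPrimeTransport.ReciprocityUpToIrreducibility) :
    PotentiallyAutomorphicAbelianVarietyTR g := by
  intro K _ _ _ A _hdim ℓ _ b r _hfr hirr hunr hdR ι
  obtain ⟨Rec, hall⟩ := hE K
  have hcpt : isCompact_glFiniteIntegralLevel (2 * g) K := isCompact_glFiniteIntegralLevel_holds (2 * g) K
  have hB : GaloisToAutomorphic (2 * g) Rec hcpt := (hall (2 * g) (by omega) hcpt).2
  have hgeo : IsGeometricFramed Rec r := ⟨hunr, fun w hw => hdR w hw⟩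
  obtain ⟨π, hLalg, hcorr⟩ := hB ℓ ι r hirr hgeo
  exact ⟨K, inferInstance, inferInstance, inferInstance, IsGalois.self K, hcpt, π.1, hLalg,
    hcorr.1.mono fun _ hv => Theorems.ReciprocityTRCM.satakeFrobCompatibleAt_restrictField_self ι π.1 hv⟩

/-- `E → rung`. -/
theorem AbelianThreefoldPotentialAutomorphy_of_top
    (hE : Summit.Langlands.Langlands.Theses.OrdinaryPrimeTransport.ReciprocityUpToIrreducibility) :
    AbelianThreefoldPotentialAutomorphy :=
  potAut_of_top 3 (by norm_num) hE

/-- `Langlands → PotentiallyAutomorphicAbelianVarietyTR g` for every `g ≥ 1` (the F4 on-path lemma). -/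
theorem potAut_of_langlands (g : ℕ) (hg : 1 ≤ g) (hL : _root_.Langlands) :
    PotentiallyAutomorphicAbelianVarietyTR g := by
  intro K _ _ _ A _hdim ℓ _ b r _hfr hirr hunr hdR ι
  obtain ⟨⟨Rec⟩, hall⟩ := hL K
  have hcpt : isCompact_glFiniteIntegralLevel (2 * g) K := isCompact_glFiniteIntegralLevel_holds (2 * g) K
  have hB : GaloisToAutomorphic (2 * g) Rec hcpt := (hall Rec (2 * g) (by omega) hcpt).2
  have hgeo : IsGeometricFramed Rec r := ⟨hunr, fun w hw => hdR w hw⟩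
  obtain ⟨π, hLalg, hcorr⟩ := hB ℓ ι r hirr hgeo
  exact ⟨K, inferInstance, inferInstance, inferInstance, IsGalois.self K, hcpt, π.1, hLalg,
    hcorr.1.mono fun _ hv => Theorems.ReciprocityTRCM.satakeFrobCompatibleAt_restrictField_self ι π.1 hv⟩

/-- **F4 on-path lemma**: `S → Rung`. -/
@[aesop safe apply]
theorem AbelianThreefoldPotentialAutomorphy_of_Langlands (hL : _root_.Langlands) : AbelianThreefoldPotentialAutomorphy :=
  potAut_of_langlands 3 (by norm_num) hL

end Summit.Langlands.Langlands.Cruxes.ReciprocityUpToIrreducibility.AbelianThreefoldPotentialAutomorphy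

end
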